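import Literature.MathematicalPhysics.QuantumLattice.HubbardLinkedCluster
import Literature.MathematicalPhysics.QuantumLattice.OrderedIntegralSymmetric
import HarnessLib

/-!
# The linked-cluster recursion for the vacuum Dyson series (`log Z`, ordered-integral form)

Topic `MathematicalPhysics/QuantumLattice`; companion of `HubbardLinkedCluster.lean`. There the
determinant (Dyson) expansion of the two-point function of `dΓ(h) + U Σ_x n_{x↑}n_{x↓}` is factorised
as `a = t ⋆ b` (numerator = connected diagrams × vacuum diagrams). Here the same block decomposition is
run for the VACUUM series `Tr e^{-β(dΓ(h)+U D)} = Σ_k U^k b_k`,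
`b_k = ∫_{Δ_k} (-β)^k Σ_{x⃗} Z₀ det G'_k(x⃗, -βu) du` (`vacuumIntegrand`, `hasSum_hubbard_partitionFn_det`),
with a PINNED vertex: peeling off the truncated expectation of the block containing vertex `i₀`
(`UrsellInversion.sum_ursellOf_mul_eq` for the determinant moments of the vacuum word over the
vertex clusters `vacuumCluster`), re-indexing the blocks through the functoriality of moments and
Ursell functions (`FermionicTree.moment_map_eq`, `ursellOf_moment_map_eq`) along the pair embeddings
`pairMap`, factorising the vertex sums (`sum_tupleOn_mul_tupleOn`), averaging over the pinned vertex
and shuffling the ordered time integrals (`orderedIntegral_sum_tupleOn_mul`) gives the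
**linked-cluster recursion**

`k · b_k = Σ_{j+m=k} j · c_j · b_m`,  `c_j = ∫_{Δ_j} (-β)^j Σ_{x⃗ ∈ Λ^j} 𝓔ᵀ(n_{x₁↑}n_{x₁↓}(s₁); …; n_{x_j↑}n_{x_j↓}(s_j)) du`

(`vacuum_linkedCluster_recursion`), i.e. `Z'(U) = C'(U) Z(U)` for the generating functions — the
combinatorial half of `log Z = log Z₀ + Σ_j U^j c_j` (Brydges 1986 §2; Benfatto–Giuliani–Mastropietro
2006 (2.13); Mastropietro 2008 (2.35)–(2.36)); the analytic half (convergence of `Σ U^j c_j` uniformly in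
the volume) is the single-scale estimate of `PropMatrixTruncatedBound.lean`. The connected coefficient
`c_j` is written out in terms of the tree's `ursellOf`, `FermionicTree.moment`, `vacuumCluster`,
`vacuumPropMatrix`, `orderedIntegral`; no definition is introduced.

* `vacuumCluster_pairMap`, `mem_range_pairMap`, `vacuumPropMatrix_submatrix_pairMap` — bookkeeping of
  the pair embedding `(i, r) ↦ (e i, r)` along an increasing map of vertices;
* `det_vacuumPropMatrix_eq_sum_pinned` — `det G'_k = Σ_{S ∋ i₀} 𝓔ᵀ_{|S|}(S) · det G'_{|Sᶜ|}(Sᶜ)`;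
* `vacuumIntegrand_eq_sum_pinned`, `mul_vacuumIntegrand_eq_sum` — the same for the integrands, and
  averaged over the pinned vertex (`k · B_k(u) = Σ_S |S| C_{|S|}(u|_S) B_{|Sᶜ|}(u|_{Sᶜ})`);
* `continuous_vacuumUrsellIntegrand` — continuity of the connected integrand;
* **`vacuum_linkedCluster_recursion`** — `k b_k = Σ_{j+m=k} j c_j b_m`.

Everything is PROVED; no definition and no named fact.

## References
* D. C. Brydges, *A short course on cluster expansions*, Les Houches 1984, §2. [cite: Brydges1986, §2]
* G. Benfatto, A. Giuliani, V. Mastropietro, Ann. Henri Poincaré 7 (2006) 809–898, §2.2 (2.13)–(2.16).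
  [cite: BenfattoGiulianiMastropietro2006, §2.2 (2.13)]
* V. Mastropietro, *Non-Perturbative Renormalization* (2008), §2.3 (2.35)–(2.36). [cite: Mastropietro2008, §2.3]
-/

noncomputable section

open scoped Matrix.Norms.L2Operator ComplexOrder
open Finset MeasureTheory intervalIntegral Filter Topology NormedSpace
open Literature.Probability.LatticeModels (ursellOf)

namespace Literature.MathematicalPhysics.QuantumLattice

/-! ### The pair embedding along an increasing map of vertices -/

section Pairs

variable {j k : ℕ}

/-- The vertex of a re-indexed pair is the image vertex. [folklore] -/
theorem vacuumCluster_pairMap (e : Fin j → Fin k) (m : Fin (j * 2)) :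
    vacuumCluster k (pairMap e m) = e (vacuumCluster j m) := by
  simp only [vacuumCluster, finProdFinEquiv_symm_pairMap]

/-- A pair whose vertex lies in the range of `e` is a re-indexed pair. [folklore] -/
theorem mem_range_pairMap (e : Fin j ↪o Fin k) (a : Fin (k * 2))
    (ha : vacuumCluster k a ∈ Set.range e) :
    a ∈ Set.range (OrderEmbedding.ofStrictMono (pairMap e) (pairMap_strictMono e.strictMono)) := by
  obtain ⟨i, hi⟩ := ha
  refine ⟨finProdFinEquiv (i, (finProdFinEquiv.symm a).2), ?_⟩
  rw [OrderEmbedding.coe_ofStrictMono]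
  apply finProdFinEquiv.symm.injective
  rw [finProdFinEquiv_symm_pairMap, Equiv.symm_apply_apply]
  exact Prod.ext hi rfl

variable {Λ : Type*} [LinearOrder Λ] [Fintype Λ] (β : ℝ) (h : Matrix (Orb Λ) (Orb Λ) ℂ)

/-- **Restricting the vacuum propagator matrix to the pairs of the vertices `e(Fin j)`** gives the
vacuum propagator matrix of the restricted labels. [folklore] -/
theorem vacuumPropMatrix_submatrix_pairMap (f : Fin k → Λ) (s : Fin k → ℂ) (e : Fin j ↪o Fin k) :
    (vacuumPropMatrix β h f s).submatrix
        (OrderEmbedding.ofStrictMono (pairMap e) (pairMap_strictMono e.strictMono))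
        (OrderEmbedding.ofStrictMono (pairMap e) (pairMap_strictMono e.strictMono)) =
      vacuumPropMatrix β h (f ∘ e) (s ∘ e) := by
  unfold vacuumPropMatrix
  rw [propMatrix_submatrix]
  congr 1
  · funext p
    simp
  · funext p
    simp
  · funext p
    simp

end Pairs

/-! ### The pinned block decomposition of the vacuum determinant -/

section Pinned

variable {Λ : Type*} [LinearOrder Λ] [Fintype Λ] (β : ℝ) (h : Matrix (Orb Λ) (Orb Λ) ℂ)

/-- A finite set of `Fin k` is the image of `Fin |S|` under its increasing enumeration. [folklore] -/
theorem eq_map_orderEmbOfFin_univ {k : ℕ} (S : Finset (Fin k)) :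
    S = (univ : Finset (Fin S.card)).map (S.orderEmbOfFin rfl).toEmbedding :=
  (Finset.map_orderEmbOfFin_univ S rfl).symm

/-- **The pinned block (linked-cluster) decomposition of the vacuum determinant**: for every vertex
`i₀`, peeling off the truncated expectation of the block of vertices containing `i₀`,
`det G'_k(f, s) = Σ_{S ∋ i₀} 𝓔ᵀ_{|S|}(f|_S, s|_S) · det G'_{|Sᶜ|}(f|_{Sᶜ}, s|_{Sᶜ})`
(`sum_ursellOf_mul_eq` for the determinant moments of the vacuum word, re-indexed through the
functoriality of moments and Ursell functions along the pair embeddings). Brydges 1986 §2;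
BGM 2006 (2.13)–(2.16). [cite: BenfattoGiulianiMastropietro2006, §2.2 (2.13)] -/
theorem det_vacuumPropMatrix_eq_sum_pinned {k : ℕ} (f : Fin k → Λ) (s : Fin k → ℂ) (i₀ : Fin k) :
    (vacuumPropMatrix β h f s).det =
      ∑ S ∈ (univ : Finset (Fin k)).powerset.filter (fun S => i₀ ∈ S),
        ursellOf (FermionicTree.moment (vacuumCluster S.card)
            (vacuumPropMatrix β h (tupleOn S rfl f) (tupleOn S rfl s))) univ *
          (vacuumPropMatrix β h (tupleOn Sᶜ rfl f) (tupleOn Sᶜ rfl s)).det := by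
  set M := vacuumPropMatrix β h f s with hM
  rw [← FermionicTree.moment_univ (vacuumCluster k) M,
    ← Literature.Probability.LatticeModels.sum_ursellOf_mul_eq
      (FermionicTree.moment (vacuumCluster k) M) (FermionicTree.moment_empty _ _) (Finset.mem_univ i₀)]
  refine Finset.sum_congr rfl fun S _ => ?_
  congr 1
  · -- the block of `i₀`: truncated expectation of the `|S|`-vertex vacuum word
    conv_lhs => rw [eq_map_orderEmbOfFin_univ S]
    rw [FermionicTree.ursellOf_moment_map_eq (vacuumCluster k) M (vacuumCluster S.card)
        (OrderEmbedding.ofStrictMono (pairMap (S.orderEmbOfFin rfl))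
          (pairMap_strictMono (S.orderEmbOfFin rfl).strictMono))
        (S.orderEmbOfFin rfl).toEmbedding
        (fun a' => by
          rw [OrderEmbedding.coe_ofStrictMono, vacuumCluster_pairMap]; rfl)
        (fun a ha => mem_range_pairMap _ a ha),
      hM, vacuumPropMatrix_submatrix_pairMap]
    rfl
  · -- the remaining vertices: the vacuum moment of the `|Sᶜ|`-vertex word
    rw [← Finset.compl_eq_univ_sdiff]
    conv_lhs => rw [eq_map_orderEmbOfFin_univ Sᶜ]
    rw [FermionicTree.moment_map_eq (vacuumCluster k) M (vacuumCluster Sᶜ.card)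
        (OrderEmbedding.ofStrictMono (pairMap (Sᶜ.orderEmbOfFin rfl))
          (pairMap_strictMono (Sᶜ.orderEmbOfFin rfl).strictMono))
        (Sᶜ.orderEmbOfFin rfl).toEmbedding
        (fun a' => by
          rw [OrderEmbedding.coe_ofStrictMono, vacuumCluster_pairMap]; rfl)
        (fun a ha => mem_range_pairMap _ a ha),
      FermionicTree.moment_univ, hM, vacuumPropMatrix_submatrix_pairMap]
    rfl

/-! ### The integrands -/

/-- **The vacuum integrand splits into connected and vacuum parts over the blocks containing a
pinned vertex**: with `C_j(v) = (-β)^j Σ_{g ∈ Λ^j} 𝓔ᵀ_j(g, -βv)` the connected integrand,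
`(-β)^k Σ_f Z₀ det G'_k(f, -βu) = Σ_{S ∋ i₀} C_{|S|}(u|_S) · B_{|Sᶜ|}(u|_{Sᶜ})`. [folklore] -/
theorem vacuumIntegrand_eq_sum_pinned (Z₀ : ℂ) {k : ℕ} (u : Fin k → ℝ) (i₀ : Fin k) :
    vacuumIntegrand β h Z₀ k u =
      ∑ S ∈ (univ : Finset (Fin k)).powerset.filter (fun S => i₀ ∈ S),
        ((-(β : ℂ)) ^ S.card * ∑ g : Fin S.card → Λ,
          ursellOf (FermionicTree.moment (vacuumCluster S.card)
            (vacuumPropMatrix β h g (fun i => (((tupleOn S rfl u) i : ℝ) : ℂ) * -(β : ℂ)))) univ) *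
        vacuumIntegrand β h Z₀ Sᶜ.card (tupleOn Sᶜ rfl u) := by
  have hk : ∀ S : Finset (Fin k), (-(β : ℂ)) ^ k = (-(β : ℂ)) ^ S.card * (-(β : ℂ)) ^ Sᶜ.card := by
    intro S
    rw [← pow_add, Finset.card_add_card_compl, Fintype.card_fin]
  unfold vacuumIntegrand
  have step1 : ∀ f : Fin k → Λ,
      Z₀ * (vacuumPropMatrix β h f (fun i => ((u i : ℝ) : ℂ) * -(β : ℂ))).det =
        ∑ S ∈ (univ : Finset (Fin k)).powerset.filter (fun S => i₀ ∈ S),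
          Z₀ * (ursellOf (FermionicTree.moment (vacuumCluster S.card)
            (vacuumPropMatrix β h (tupleOn S rfl f)
              (tupleOn S rfl fun i => ((u i : ℝ) : ℂ) * -(β : ℂ)))) univ *
          (vacuumPropMatrix β h (tupleOn Sᶜ rfl f)
            (tupleOn Sᶜ rfl fun i => ((u i : ℝ) : ℂ) * -(β : ℂ))).det) := by
    intro f
    rw [det_vacuumPropMatrix_eq_sum_pinned β h f _ i₀, Finset.mul_sum]
  simp_rw [step1]
  rw [Finset.sum_comm, Finset.mul_sum]
  refine Finset.sum_congr rfl fun S _ => ?_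
  have e1 : (tupleOn S rfl fun i => ((u i : ℝ) : ℂ) * -(β : ℂ)) =
      fun i => (((tupleOn S rfl u) i : ℝ) : ℂ) * -(β : ℂ) := rfl
  have e2 : (tupleOn Sᶜ rfl fun i => ((u i : ℝ) : ℂ) * -(β : ℂ)) =
      fun i => (((tupleOn Sᶜ rfl u) i : ℝ) : ℂ) * -(β : ℂ) := rfl
  rw [e1, e2]
  have hsplit := sum_tupleOn_mul_tupleOn (X := Λ) S rfl rfl
    (fun g : Fin S.card → Λ => ursellOf (FermionicTree.moment (vacuumCluster S.card)
      (vacuumPropMatrix β h g (fun i => (((tupleOn S rfl u) i : ℝ) : ℂ) * -(β : ℂ)))) univ)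
    (fun g : Fin Sᶜ.card → Λ => Z₀ * (vacuumPropMatrix β h g
      (fun i => (((tupleOn Sᶜ rfl u) i : ℝ) : ℂ) * -(β : ℂ))).det)
  rw [hk S, Finset.sum_congr rfl fun (f : Fin k → Λ) _ => mul_left_comm Z₀
    (ursellOf (FermionicTree.moment (vacuumCluster S.card)
      (vacuumPropMatrix β h (tupleOn S rfl f) (fun i => (((tupleOn S rfl u) i : ℝ) : ℂ) * -(β : ℂ)))) univ)
    ((vacuumPropMatrix β h (tupleOn Sᶜ rfl f)
      (fun i => (((tupleOn Sᶜ rfl u) i : ℝ) : ℂ) * -(β : ℂ))).det), hsplit]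
  ring

/-- **Averaging over the pinned vertex**: `k · B_k(u) = Σ_{S ⊆ [k]} |S| · C_{|S|}(u|_S) · B_{|Sᶜ|}(u|_{Sᶜ})`.
[folklore] -/
theorem mul_vacuumIntegrand_eq_sum (Z₀ : ℂ) {k : ℕ} (u : Fin k → ℝ) :
    (k : ℂ) * vacuumIntegrand β h Z₀ k u =
      ∑ S : Finset (Fin k),
        ((S.card : ℂ) * ((-(β : ℂ)) ^ S.card * ∑ g : Fin S.card → Λ,
          ursellOf (FermionicTree.moment (vacuumCluster S.card)
            (vacuumPropMatrix β h g (fun i => (((tupleOn S rfl u) i : ℝ) : ℂ) * -(β : ℂ)))) univ)) *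
        vacuumIntegrand β h Z₀ Sᶜ.card (tupleOn Sᶜ rfl u) := by
  classical
  -- sum the pinned decomposition over the pinned vertex
  have hsum : ∑ _i₀ : Fin k, vacuumIntegrand β h Z₀ k u = (k : ℂ) * vacuumIntegrand β h Z₀ k u := by
    rw [Finset.sum_const, Finset.card_univ, Fintype.card_fin, nsmul_eq_mul]
  rw [← hsum, Finset.sum_congr rfl fun i₀ _ => vacuumIntegrand_eq_sum_pinned β h Z₀ u i₀]
  -- exchange: `Σ_{i₀} Σ_{S ∋ i₀} X_S = Σ_S |S| X_S`
  rw [Finset.sum_comm' (t' := univ)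
    (s' := fun S : Finset (Fin k) => univ.filter fun i₀ : Fin k => i₀ ∈ S)
    (h := fun i₀ S => by simp)]
  refine Finset.sum_congr rfl fun S _ => ?_
  rw [Finset.sum_const, nsmul_eq_mul, Finset.filter_mem_eq_inter, Finset.univ_inter]
  ring

/-- The connected vacuum integrand `C_j(v) = (-β)^j Σ_{g ∈ Λ^j} 𝓔ᵀ_j(g, -βv)` is continuous.
[folklore] -/
theorem continuous_vacuumUrsellIntegrand (j : ℕ) :
    Continuous fun v : Fin j → ℝ => (-(β : ℂ)) ^ j * ∑ g : Fin j → Λ,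
      ursellOf (FermionicTree.moment (vacuumCluster j)
        (vacuumPropMatrix β h g (fun i => ((v i : ℝ) : ℂ) * -(β : ℂ)))) univ := by
  refine continuous_const.mul (continuous_finsetSum _ fun g _ => ?_)
  refine FermionicTree.continuous_ursellOf
    (fun (v : Fin j → ℝ) P => FermionicTree.moment (vacuumCluster j)
      (vacuumPropMatrix β h g (fun i => ((v i : ℝ) : ℂ) * -(β : ℂ))) P) (fun P => ?_) _
  refine FermionicTree.continuous_moment (vacuumCluster j) _ (fun a b => ?_) P
  unfold vacuumPropMatrix
  exact continuous_propMatrix_apply β h _ _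
    (τ := fun (v : Fin j → ℝ) (p : Fin (j * 2)) => ((v (finProdFinEquiv.symm p).1 : ℝ) : ℂ) * -(β : ℂ))
    (fun p => continuous_time_coord β _) a b

/-! ### The recursion -/

/-- **The linked-cluster recursion for the vacuum Dyson series** (ordered-integral form of
`Z' = C' Z`, i.e. of `log Z = log Z₀ + Σ_j U^j c_j`): with the vacuum coefficients
`b_m = ∫_{Δ_m} (-β)^m Σ_{x⃗} Z₀ det G'_m(x⃗, -βw) dw` and the connected coefficients
`c_j = ∫_{Δ_j} (-β)^j Σ_{x⃗ ∈ Λ^j} 𝓔ᵀ(n_{x₁↑}n_{x₁↓}(s₁); …; n_{x_j↑}n_{x_j↓}(s_j)) dv` (`s_i = -βv_i`; the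
truncated expectation being the Ursell function of the determinant moments of the vacuum word),
`k · b_k = Σ_{j+m=k} j · c_j · b_m` for every `k` — pinned block decomposition, average over the
pinned vertex, and the shuffle product of the ordered time integrals. Brydges 1986 §2;
BGM 2006 (2.13); Mastropietro 2008 (2.35)–(2.36). [cite: Brydges1986, §2] -/
theorem vacuum_linkedCluster_recursion (Z₀ : ℂ) (k : ℕ) :
    (k : ℂ) * orderedIntegral k (vacuumIntegrand β h Z₀ k) 1 =
      ∑ p ∈ antidiagonal k, (p.1 : ℂ) *
        orderedIntegral p.1 (fun v : Fin p.1 → ℝ => (-(β : ℂ)) ^ p.1 * ∑ g : Fin p.1 → Λ,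
          ursellOf (FermionicTree.moment (vacuumCluster p.1)
            (vacuumPropMatrix β h g (fun i => ((v i : ℝ) : ℂ) * -(β : ℂ)))) univ) 1 *
        orderedIntegral p.2 (vacuumIntegrand β h Z₀ p.2) 1 := by
  -- the weighted connected family `j ↦ j · C_j`
  set F : (j : ℕ) → (Fin j → ℝ) → ℂ := fun j v => ((-(β : ℂ)) ^ j * ∑ g : Fin j → Λ,
      ursellOf (FermionicTree.moment (vacuumCluster j)
        (vacuumPropMatrix β h g (fun i => ((v i : ℝ) : ℂ) * -(β : ℂ)))) univ) * (j : ℂ) with hF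
  have hFcont : ∀ j, Continuous (F j) := fun j =>
    (continuous_vacuumUrsellIntegrand β h j).mul continuous_const
  -- `k B_k = Σ_S F_{|S|}(u_S) B_{|Sᶜ|}(u_{Sᶜ})`
  have hfun : (fun u : Fin k → ℝ => (k : ℂ) * vacuumIntegrand β h Z₀ k u) = fun u =>
      ∑ S : Finset (Fin k), F S.card (tupleOn S rfl u) * vacuumIntegrand β h Z₀ Sᶜ.card (tupleOn Sᶜ rfl u) := by
    funext u
    rw [mul_vacuumIntegrand_eq_sum β h Z₀ u]
    refine Finset.sum_congr rfl fun S _ => ?_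
    simp only [hF]
    ring
  have hlhs : (k : ℂ) * orderedIntegral k (vacuumIntegrand β h Z₀ k) 1 =
      orderedIntegral k (fun u : Fin k → ℝ => (k : ℂ) * vacuumIntegrand β h Z₀ k u) 1 := by
    rw [mul_comm, ← orderedIntegral_mul_const]
    congr 1
    funext u
    ring
  rw [hlhs, hfun, orderedIntegral_sum_tupleOn_mul k F (vacuumIntegrand β h Z₀) hFcont
    (continuous_vacuumIntegrand β h Z₀) 1]
  refine Finset.sum_congr rfl fun p _ => ?_
  simp only [hF]
  rw [orderedIntegral_mul_const]
  ring

end Pinned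

end Literature.MathematicalPhysics.QuantumLattice
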